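import Mathlib.Algebra.Field.ZMod
import Mathlib.Data.Nat.Bitwise
import Mathlib.Data.List.Sort
import Literature.Computability.AlgebraicComplexity.FlipGraphEquivariance
import Literature.Computability.AlgebraicComplexity.FlipGraphLadermanIsolatedKM
import HarnessLib

/-!
# A verified flip enumerator and orbit matcher for the `(2,2,2)`-flip graph over `ℤ₂` (KM 2023, §4)

Topic `Literature/Computability/AlgebraicComplexity`; infrastructure for kernel certificates about
the `(2,2,2)`-flip graph over `K = ℤ₂` of M. Kauers, J. Moosbauer, *Flip Graphs for Matrix
Multiplication*, ISSAC 2023 = arXiv:2212.01175 (KM), §4 ("The `(2,2,2)`-flip graph of rank at most `8`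
for `K = ℤ₂` is not too big …"), over the vocabulary of `FlipGraphConnectivity.lean` (KM Def. 1
`Scheme` as a multiset of rank-one tensors, Def. 4 `Flips`, Prop. 3 `Reduces`),
`FlipGraphSymmetry.lean` / `FlipGraphEquivariance.lean` (KM's symmetry group `InSymmetryGroup`:
sandwiches, transposition, cyclic shift) and `FlipGraphLadermanIsolatedKM.lean`
(`triad_factors_eq_of_two`: over `ℤ₂` a non-zero rank-one tensor determines its factors).
Everything is PROVED; no named facts. Used by `FlipGraphStdStrassenDistance.lean` (KM §4: "The
distance between the standard algorithm and Strassen's algorithm is `8`", the lower bound).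

## Contents (all for `2 × 2` factor matrices over `ZMod 2`)

* §1 Codes: a `2 × 2` matrix over `ℤ₂` (a factor `Fin 2 × Fin 2 → ZMod 2`) is the natural number
  `< 16` whose bit `2 i + j` is the entry `(i, j)` (`dec`, `enc`; `dec_xor`: addition is `xor`).
* §2 Code triples `(z, x, y)` present rank-one tensors `tr3`, lists of them present multisets of
  tensors `elts3`; the slot permutations of `FlipGraphConnectivity.lean` on code triples.
* §3 `picks`: removing one element of a list, and the bookkeeping lemma matching
  `elts3 L = T ::ₘ M` with a position of `L`.
* §4 **The flip enumerator** `flipsAll` and its COMPLETENESS over `ℤ₂`: every flip (KM Def. 4, the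
  tree's `Flips`, shared factor in any slot, either choice of `T`) of the multiset presented by a
  well-formed code list is presented by a member of `flipsAll` (`exists_mem_flipsAll_of_flips`).
* §5 **The irreducibility test** `irrB` (KM Def. 2 over `ℤ₂`: no element whose second factor lies in
  the `ℤ₂`-span of the second factors of the other elements sharing its first factor, in all six
  slot arrangements) and its SOUNDNESS: `irrB L = true` excludes every reduction (the tree's
  `Reduces`, Prop. 3's construction) of the presented multiset (`not_reduces_of_irrB`).
* §6 KM's symmetry group on codes: `GL₂(ℤ₂)` (six matrices `glMat`), the table `pxq` of
  `X ↦ P X Qᵀ`, transposition `tc`; a word `g = (k, i_P, i_Q, i_R)` names the symmetry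
  `symOf g = σ_k ∘ sandwich(P, Q, R)` (`σ_k` one of the six products of the cyclic shift and the
  transposition), `inSymmetryGroup_symOf`, and `symOf` acts on presented tensors by the code map
  `actTri` (`symOf_tr3`).
* §7 Matching up to order: `sortT` (insertion sort by a numeric key); equal sorted lists present
  equal multisets (`elts3_eq_of_sortT_eq`).

HONEST FRAMING: bookkeeping for finite kernel computations over `ℤ₂` and `2 × 2` matrices; no
statement about other fields or formats. The design (bit codes, Boolean checkers proved sound once,
data replayed by `decide`) follows the tree's `GF2MatrixBits`-style certificates.

## References

* M. Kauers, J. Moosbauer, *Flip Graphs for Matrix Multiplication*, ISSAC 2023, 381–388,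
  doi:10.1145/3597066.3597120, arXiv:2212.01175: Def. 1, Def. 2, Prop. 3, Def. 4, §2 (symmetry
  group), §4 (the `(2,2,2)`-flip graph over `ℤ₂`). [KauersMoosbauer2022FlipGraphs]
-/

set_option Elab.async false

namespace Literature.Computability.AlgebraicComplexity

open scoped BigOperators Kronecker
open Multiset Matrix

namespace FlipGraph

namespace Cert222

/-! ## §1 Four-bit codes of `2 × 2` matrices over `ℤ₂` -/

/-- The factor space: `2 × 2` matrices over `ℤ₂` as functions on positions (KM's `A, B, Γ`).
[cite: KauersMoosbauer2022FlipGraphs, Def. 1] -/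
abbrev F : Type := Fin 2 × Fin 2 → ZMod 2

/-- The tensor space containing `⟨2,2,2⟩` over `ℤ₂` (slots: output pattern `Z`, `A`-form `X`,
`B`-form `Y`). [cite: KauersMoosbauer2022FlipGraphs, Def. 1] -/
abbrev T : Type := (Fin 2 × Fin 2) → (Fin 2 × Fin 2) → (Fin 2 × Fin 2) → ZMod 2

/-- Every scalar of `ℤ₂` is `0` or `1`. [folklore] -/
private theorem zmod_two_eq : ∀ x : ZMod 2, x = 0 ∨ x = 1 := by decide

/-- The bit position `2 i + j` of the entry `(i, j)`. [folklore] -/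
def bitPos (p : Fin 2 × Fin 2) : ℕ := 2 * p.1.val + p.2.val

/-- **Decoding**: the matrix whose entry `(i, j)` is bit `2 i + j` of `v`. [folklore] -/
def dec (v : ℕ) : F := fun p => if v.testBit (bitPos p) then 1 else 0

/-- **Encoding**: the number `< 16` whose bit `2 i + j` is the entry `(i, j)`. [folklore] -/
def enc (f : F) : ℕ :=
  (f (0, 0)).val + 2 * (f (0, 1)).val + 4 * (f (1, 0)).val + 8 * (f (1, 1)).val

/-- Addition of matrices over `ℤ₂` is `xor` of codes. [folklore] -/
private theorem dec_xor (v w : ℕ) : dec (v ^^^ w) = dec v + dec w := by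
  funext p
  simp only [dec, Nat.testBit_xor, Pi.add_apply]
  cases v.testBit (bitPos p) <;> cases w.testBit (bitPos p) <;> decide

/-- `dec 0 = 0`. [folklore] -/
private theorem dec_zero : dec 0 = 0 := by
  funext p; simp [dec]

/-- Codes `< 16` round-trip. [folklore] -/
private theorem enc_dec : ∀ v < 16, enc (dec v) = v := by decide

/-- Matrices round-trip. [folklore] -/
private theorem dec_enc : ∀ f : F, dec (enc f) = f := by decide

/-- Codes of matrices are `< 16`. [folklore] -/
private theorem enc_lt : ∀ f : F, enc f < 16 := by decide

/-- `enc` is additive-to-`xor`. [folklore] -/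
private theorem enc_add (f g : F) : enc (f + g) = enc f ^^^ enc g := by
  have h : dec (enc (f + g)) = dec (enc f ^^^ enc g) := by rw [dec_xor, dec_enc, dec_enc, dec_enc]
  have := congrArg enc h
  rwa [enc_dec, enc_dec] at this
  · exact Nat.xor_lt_two_pow (n := 4) (enc_lt f) (enc_lt g)
  · exact enc_lt _

/-- `dec` is injective on codes `< 16`. [folklore] -/
private theorem dec_injOn {v w : ℕ} (hv : v < 16) (hw : w < 16) (h : dec v = dec w) : v = w := by
  have := congrArg enc h
  rwa [enc_dec v hv, enc_dec w hw] at this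

/-- A non-zero code `< 16` decodes to a non-zero matrix. [folklore] -/
private theorem dec_ne_zero {v : ℕ} (hv : v < 16) (h0 : v ≠ 0) : dec v ≠ 0 := by
  intro h
  exact h0 (dec_injOn hv (by norm_num) (h.trans dec_zero.symm))

/-- `xor` of codes `< 16` is `< 16`. [folklore] -/
private theorem xor_lt16 {v w : ℕ} (hv : v < 16) (hw : w < 16) : v ^^^ w < 16 :=
  Nat.xor_lt_two_pow (n := 4) hv hw

/-! ## §2 Code triples, presented multisets, slot permutations -/

/-- A code triple `(z, x, y)`: the codes of the three factors of a rank-one tensor `Z ⊗ X ⊗ Y`.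
[cite: KauersMoosbauer2022FlipGraphs, Def. 1] -/
abbrev Tri : Type := ℕ × ℕ × ℕ

/-- The rank-one tensor presented by a code triple. [cite: KauersMoosbauer2022FlipGraphs, Def. 1] -/
def tr3 (p : Tri) : T := triad (dec p.1) (dec p.2.1) (dec p.2.2)

/-- The multiset of tensors presented by a list of code triples (a scheme, KM Def. 1, when its sum
is `⟨2,2,2⟩`). [cite: KauersMoosbauer2022FlipGraphs, Def. 1] -/
def elts3 (L : List Tri) : Multiset T := ((L.map tr3 : List T) : Multiset T)

/-- Well-formed code: non-zero and `< 16` (a NON-ZERO factor matrix). [folklore] -/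
def wfC (v : ℕ) : Bool := (0 < v) && (v < 16)

/-- Well-formed code triple. [folklore] -/
def wfT (p : Tri) : Bool := wfC p.1 && wfC p.2.1 && wfC p.2.2

/-- Well-formed list of code triples. [folklore] -/
def wfL (L : List Tri) : Bool := L.all wfT

/-- Unpacking `wfC`. [folklore] -/
private theorem wfC_iff {v : ℕ} : wfC v = true ↔ 0 < v ∧ v < 16 := by
  simp [wfC]

/-- Unpacking `wfT`. [folklore] -/
private theorem wfT_iff {p : Tri} :
    wfT p = true ↔ (0 < p.1 ∧ p.1 < 16) ∧ (0 < p.2.1 ∧ p.2.1 < 16) ∧ (0 < p.2.2 ∧ p.2.2 < 16) := by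
  simp [wfT, wfC_iff, Bool.and_eq_true, and_assoc]

/-- Unpacking `wfL`. [folklore] -/
private theorem wfL_iff {L : List Tri} : wfL L = true ↔ ∀ p ∈ L, wfT p = true := by
  simp [wfL, List.all_eq_true]

/-- A rank-one tensor with a zero factor vanishes. [folklore] -/
private theorem triad_eq_zero_of_factor {a b c : F} (h : a = 0 ∨ b = 0 ∨ c = 0) :
    triad a b c = (0 : T) := by
  funext x y z
  rcases h with rfl | rfl | rfl <;> simp [triad_apply]

/-- Over a field, a rank-one tensor with non-zero factors is non-zero. [folklore] -/
private theorem triad_ne_zero_of_factors {a b c : F} (ha : a ≠ 0) (hb : b ≠ 0) (hc : c ≠ 0) :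
    triad a b c ≠ (0 : T) := by
  obtain ⟨x, hx⟩ := Function.ne_iff.mp ha
  obtain ⟨y, hy⟩ := Function.ne_iff.mp hb
  obtain ⟨z, hz⟩ := Function.ne_iff.mp hc
  intro h
  have h' := congrFun (congrFun (congrFun h x) y) z
  simp only [triad_apply, Pi.zero_apply] at h'
  exact mul_ne_zero (mul_ne_zero hx hy) hz h'

/-- A well-formed code triple presents a NON-ZERO rank-one tensor (Def. 1).
[cite: KauersMoosbauer2022FlipGraphs, Def. 1] -/
theorem tr3_ne_zero {p : Tri} (hp : wfT p = true) : tr3 p ≠ 0 := by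
  obtain ⟨⟨h1, h1'⟩, ⟨h2, h2'⟩, ⟨h3, h3'⟩⟩ := wfT_iff.mp hp
  exact triad_ne_zero_of_factors (dec_ne_zero h1' (Nat.pos_iff_ne_zero.mp h1))
    (dec_ne_zero h2' (Nat.pos_iff_ne_zero.mp h2)) (dec_ne_zero h3' (Nat.pos_iff_ne_zero.mp h3))

/-- A code triple with a zero entry presents the zero tensor. [folklore] -/
private theorem tr3_eq_zero_of_zero {p : Tri} (h : p.1 = 0 ∨ p.2.1 = 0 ∨ p.2.2 = 0) : tr3 p = 0 := by
  unfold tr3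
  rcases h with h | h | h <;> rw [h, dec_zero]
  · exact triad_eq_zero_of_factor (Or.inl rfl)
  · exact triad_eq_zero_of_factor (Or.inr (Or.inl rfl))
  · exact triad_eq_zero_of_factor (Or.inr (Or.inr rfl))

/-- Membership in a presented multiset. [folklore] -/
private theorem mem_elts3 {L : List Tri} {t : T} : t ∈ elts3 L ↔ ∃ p ∈ L, tr3 p = t := by
  simp [elts3]

/-- `elts3` of a cons. [folklore] -/
private theorem elts3_cons (p : Tri) (L : List Tri) : elts3 (p :: L) = tr3 p ::ₘ elts3 L := by
  simp [elts3]

/-- `elts3` of an append. [folklore] -/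
private theorem elts3_append (L L' : List Tri) : elts3 (L ++ L') = elts3 L + elts3 L' := by
  simp [elts3, ← Multiset.coe_add]

/-- Permuted lists present the same multiset. [folklore] -/
private theorem elts3_eq_of_perm {L L' : List Tri} (h : L.Perm L') : elts3 L = elts3 L' := by
  simp only [elts3]
  exact Multiset.coe_eq_coe.mpr (h.map tr3)

/-- Slot permutation `(1 2)` on code triples: `(z, x, y) ↦ (x, z, y)`. [folklore] -/
def s12 (p : Tri) : Tri := (p.2.1, p.1, p.2.2)
/-- Slot permutation `(1 3)` on code triples: `(z, x, y) ↦ (y, x, z)`. [folklore] -/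
def s13 (p : Tri) : Tri := (p.2.2, p.2.1, p.1)
/-- Slot permutation `(2 3)` on code triples: `(z, x, y) ↦ (z, y, x)`. [folklore] -/
def s23 (p : Tri) : Tri := (p.1, p.2.2, p.2.1)
/-- Cyclic slot permutation on code triples: `(z, x, y) ↦ (x, y, z)` (matches `cyc`). [folklore] -/
def cy (p : Tri) : Tri := (p.2.1, p.2.2, p.1)
/-- The other cyclic slot permutation: `(z, x, y) ↦ (y, z, x)` (matches `cyc₂`). [folklore] -/
def cy2 (p : Tri) : Tri := (p.2.2, p.1, p.2.1)

/-- `sw₁₂ (a⊗b⊗c) = b⊗a⊗c`. [folklore] -/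
private theorem sw₁₂_tr3 (p : Tri) : sw₁₂ (tr3 p) = tr3 (s12 p) := by
  funext x y z; simp only [sw₁₂, tr3, s12, triad_apply]; ring
/-- `sw₁₃ (a⊗b⊗c) = c⊗b⊗a`. [folklore] -/
private theorem sw₁₃_tr3 (p : Tri) : sw₁₃ (tr3 p) = tr3 (s13 p) := by
  funext x y z; simp only [sw₁₃, tr3, s13, triad_apply]; ring
/-- `sw₂₃ (a⊗b⊗c) = a⊗c⊗b`. [folklore] -/
private theorem sw₂₃_tr3 (p : Tri) : sw₂₃ (tr3 p) = tr3 (s23 p) := by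
  funext x y z; simp only [sw₂₃, tr3, s23, triad_apply]; ring
/-- `cyc (a⊗b⊗c) = b⊗c⊗a`. [folklore] -/
private theorem cyc_tr3 (p : Tri) : cyc (tr3 p) = tr3 (cy p) := by
  funext x y z; simp only [cyc, tr3, cy, triad_apply]; ring
/-- `cyc₂ (a⊗b⊗c) = c⊗a⊗b`. [folklore] -/
private theorem cyc₂_tr3 (p : Tri) : cyc₂ (tr3 p) = tr3 (cy2 p) := by
  funext x y z; simp only [cyc₂, tr3, cy2, triad_apply]; ring

/-- Slot maps commute with presentation: `(elts3 L).map sw₁₂ = elts3 (L.map s12)`. [folklore] -/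
private theorem elts3_map_sw₁₂ (L : List Tri) : (elts3 L).map sw₁₂ = elts3 (L.map s12) := by
  simp [elts3, Multiset.map_coe, List.map_map, Function.comp_def, sw₁₂_tr3]
/-- `(elts3 L).map sw₁₃ = elts3 (L.map s13)`. [folklore] -/
private theorem elts3_map_sw₁₃ (L : List Tri) : (elts3 L).map sw₁₃ = elts3 (L.map s13) := by
  simp [elts3, Multiset.map_coe, List.map_map, Function.comp_def, sw₁₃_tr3]
/-- `(elts3 L).map sw₂₃ = elts3 (L.map s23)`. [folklore] -/
private theorem elts3_map_sw₂₃ (L : List Tri) : (elts3 L).map sw₂₃ = elts3 (L.map s23) := by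
  simp [elts3, Multiset.map_coe, List.map_map, Function.comp_def, sw₂₃_tr3]
/-- `(elts3 L).map cyc = elts3 (L.map cy)`. [folklore] -/
private theorem elts3_map_cyc (L : List Tri) : (elts3 L).map cyc = elts3 (L.map cy) := by
  simp [elts3, Multiset.map_coe, List.map_map, Function.comp_def, cyc_tr3]
/-- `(elts3 L).map cyc₂ = elts3 (L.map cy2)`. [folklore] -/
private theorem elts3_map_cyc₂ (L : List Tri) : (elts3 L).map cyc₂ = elts3 (L.map cy2) := by
  simp [elts3, Multiset.map_coe, List.map_map, Function.comp_def, cyc₂_tr3]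

/-- The inverse slot maps undo each other on multisets: `sw₁₂ ∘ sw₁₂ = id`. [folklore] -/
private theorem map_sw₁₂_map_sw₁₂ (U : Multiset T) : (U.map sw₁₂).map sw₁₂ = U := by
  rw [Multiset.map_map]; exact (Multiset.map_congr rfl fun x _ => rfl).trans (Multiset.map_id U)
/-- `sw₁₃ ∘ sw₁₃ = id`. [folklore] -/
private theorem map_sw₁₃_map_sw₁₃ (U : Multiset T) : (U.map sw₁₃).map sw₁₃ = U := by
  rw [Multiset.map_map]; exact (Multiset.map_congr rfl fun x _ => rfl).trans (Multiset.map_id U)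

/-- Well-formedness is a property of the three codes, stable under slot permutations. [folklore] -/
private theorem wfL_map {L : List Tri} (hL : wfL L = true) (f : Tri → Tri)
    (hf : ∀ p, wfT p = true → wfT (f p) = true) : wfL (L.map f) = true := by
  rw [wfL_iff] at hL ⊢
  intro p hp
  obtain ⟨q, hq, rfl⟩ := List.mem_map.mp hp
  exact hf q (hL q hq)

/-- `wfT` under `s12`. [folklore] -/
private theorem wfT_s12 (p : Tri) (h : wfT p = true) : wfT (s12 p) = true := by
  rw [wfT_iff] at h ⊢; exact ⟨h.2.1, h.1, h.2.2⟩
/-- `wfT` under `s13`. [folklore] -/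
private theorem wfT_s13 (p : Tri) (h : wfT p = true) : wfT (s13 p) = true := by
  rw [wfT_iff] at h ⊢; exact ⟨h.2.2, h.2.1, h.1⟩
/-- `wfT` under `s23`. [folklore] -/
private theorem wfT_s23 (p : Tri) (h : wfT p = true) : wfT (s23 p) = true := by
  rw [wfT_iff] at h ⊢; exact ⟨h.1, h.2.2, h.2.1⟩
/-- `wfT` under `cy`. [folklore] -/
private theorem wfT_cy (p : Tri) (h : wfT p = true) : wfT (cy p) = true := by
  rw [wfT_iff] at h ⊢; exact ⟨h.2.1, h.2.2, h.1⟩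
/-- `wfT` under `cy2`. [folklore] -/
private theorem wfT_cy2 (p : Tri) (h : wfT p = true) : wfT (cy2 p) = true := by
  rw [wfT_iff] at h ⊢; exact ⟨h.2.2, h.1, h.2.1⟩

/-! ## §3 Picking one element of a list -/

/-- All ways of removing one element from a list: the pairs (element at position `i`, list without
position `i`), in the order of `i`. [folklore] -/
def picks {α : Type} : List α → List (α × List α)
  | [] => []
  | a :: l => (a, l) :: (picks l).map fun pr => (pr.1, a :: pr.2)

/-- A pick consists of members: the picked element is a member … [folklore] -/
private theorem mem_of_mem_picks_fst {α : Type} {l : List α} {pr : α × List α} (h : pr ∈ picks l) :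
    pr.1 ∈ l := by
  induction l generalizing pr with
  | nil => simp [picks] at h
  | cons a l ih =>
    simp only [picks, List.mem_cons, List.mem_map] at h
    rcases h with rfl | ⟨pr', hpr', rfl⟩
    · exact List.mem_cons_self
    · exact List.mem_cons_of_mem _ (ih (pr := pr') hpr')

/-- … and the remaining elements are members. [folklore] -/
private theorem mem_of_mem_picks_snd {α : Type} {l : List α} {pr : α × List α} (h : pr ∈ picks l) {b : α}
    (hb : b ∈ pr.2) : b ∈ l := by
  induction l generalizing pr with
  | nil => simp [picks] at h
  | cons a l ih =>
    simp only [picks, List.mem_cons, List.mem_map] at h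
    rcases h with rfl | ⟨pr', hpr', rfl⟩
    · exact List.mem_cons_of_mem _ hb
    · have hb' : b = a ∨ b ∈ pr'.2 := by simpa only [List.mem_cons] using hb
      rcases hb' with rfl | hb'
      · exact List.mem_cons_self
      · exact List.mem_cons_of_mem _ (ih (pr := pr') hpr' hb')

/-- A pick splits the presented multiset: `elts3 l = tr3 pr.1 ::ₘ elts3 pr.2`. [folklore] -/
private theorem elts3_eq_cons_of_mem_picks {l : List Tri} {pr : Tri × List Tri} (h : pr ∈ picks l) :
    elts3 l = tr3 pr.1 ::ₘ elts3 pr.2 := by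
  induction l generalizing pr with
  | nil => simp [picks] at h
  | cons a l ih =>
    simp only [picks, List.mem_cons, List.mem_map] at h
    rcases h with rfl | ⟨pr', hpr', rfl⟩
    · exact elts3_cons a l
    · rw [elts3_cons, ih hpr', elts3_cons, Multiset.cons_swap]

/-- **Bookkeeping lemma:** if the presented multiset is `t ::ₘ M`, some position of the list presents
`t` and the rest presents `M`. [folklore] -/
private theorem exists_pick_of_elts3_eq_cons :
    ∀ (l : List Tri) (t : T) (M : Multiset T), elts3 l = t ::ₘ M →
      ∃ pr ∈ picks l, tr3 pr.1 = t ∧ elts3 pr.2 = M := by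
  intro l
  induction l with
  | nil =>
    intro t M h
    exact absurd (h ▸ Multiset.mem_cons_self t M : t ∈ elts3 []) (by simp [elts3])
  | cons a l ih =>
    intro t M h
    rw [elts3_cons, Multiset.cons_eq_cons] at h
    rcases h with ⟨hat, hM⟩ | ⟨hne, cs, hl, hM⟩
    · exact ⟨(a, l), by simp [picks], hat, hM⟩
    · obtain ⟨pr, hpr, h1, h2⟩ := ih t cs hl
      refine ⟨(pr.1, a :: pr.2), ?_, h1, ?_⟩
      · simp only [picks, List.mem_cons, List.mem_map]
        exact Or.inr ⟨pr, hpr, rfl⟩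
      · rw [elts3_cons, h2, hM]

/-! ## §4 The flip enumerator and its completeness (KM Def. 4 over `ℤ₂`) -/

/-- `a⊗b⊗(c+c') = a⊗b⊗c + a⊗b⊗c'`. [folklore] -/
private theorem triad_add₃ (a b c c' : F) : triad a b (c + c') = (triad a b c + triad a b c' : T) := by
  funext x y z; simp only [triad_apply, Pi.add_apply]; ring
/-- `a⊗(b+b')⊗c = a⊗b⊗c + a⊗b'⊗c`. [folklore] -/
private theorem triad_add₂ (a b b' c : F) : triad a (b + b') c = (triad a b c + triad a b' c : T) := by
  funext x y z; simp only [triad_apply, Pi.add_apply]; ring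
/-- `a⊗b⊗(c−c') = a⊗b⊗c − a⊗b⊗c'`. [folklore] -/
private theorem triad_sub₃ (a b c c' : F) : triad a b (c - c') = (triad a b c - triad a b c' : T) := by
  funext x y z; simp only [triad_apply, Pi.sub_apply]; ring
/-- `a⊗(b−b')⊗c = a⊗b⊗c − a⊗b'⊗c`. [folklore] -/
private theorem triad_sub₂ (a b b' c : F) : triad a (b - b') c = (triad a b c - triad a b' c : T) := by
  funext x y z; simp only [triad_apply, Pi.sub_apply]; ring

/-- Over `ℤ₂`, subtraction of factor matrices is addition. [folklore] -/
private theorem sub_eq_add_F (f g : F) : f - g = f + g := by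
  have h : ∀ x y : ZMod 2, x - y = x + y := by decide
  funext p; exact h _ _

/-- **The flips with the shared factor in the FIRST slot** (KM Def. 4, the tree's `FlipBase`, written
on codes over `ℤ₂`): for every ordered pair of distinct positions `(A,B,Γ)`, `(A,B',Γ')` with the
same first code, the two code lists `(A, B, Γ+Γ'), (A, B+B', Γ'), rest` and
`(A, B+B', Γ), (A, B', Γ+Γ'), rest` (sums of matrices over `ℤ₂` are `xor`s of codes).
[cite: KauersMoosbauer2022FlipGraphs, Def. 4] -/
def flip1 (L : List Tri) : List (List Tri) :=
  (picks L).flatMap fun pr =>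
    (picks pr.2).flatMap fun qr =>
      if pr.1.1 = qr.1.1 then
        [(pr.1.1, pr.1.2.1, pr.1.2.2 ^^^ qr.1.2.2) :: (pr.1.1, pr.1.2.1 ^^^ qr.1.2.1, qr.1.2.2) :: qr.2,
          (pr.1.1, pr.1.2.1 ^^^ qr.1.2.1, pr.1.2.2) :: (pr.1.1, qr.1.2.1, pr.1.2.2 ^^^ qr.1.2.2) :: qr.2]
      else []

/-- **All flips** (KM Def. 4 "for any permutation of `A`, `B` and `Γ`"; the tree's `Flips`: the
shared factor in slot 1, 2 or 3), on codes. [cite: KauersMoosbauer2022FlipGraphs, Def. 4] -/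
def flipsAll (L : List Tri) : List (List Tri) :=
  flip1 L ++ ((flip1 (L.map s12)).map (List.map s12) ++ (flip1 (L.map s13)).map (List.map s13))

/-- **Completeness of `flip1`:** over `ℤ₂`, every `FlipBase`-flip of the multiset presented by a
well-formed code list is presented by a member of `flip1`. (Over `ℤ₂` the elements `A⊗B⊗Γ`,
`A⊗B'⊗Γ'` of Def. 4 are two POSITIONS of the list with equal first codes, and `T₁ + T`, `T₂ − T` are
computed on codes by `xor`.) [cite: KauersMoosbauer2022FlipGraphs, Def. 4] -/
theorem exists_mem_flip1_of_flipBase {L : List Tri} (hL : wfL L = true) {S' : Multiset T}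
    (h : FlipBase (elts3 L) S') : ∃ r ∈ flip1 L, S' = elts3 r := by
  obtain ⟨a, b, b', c, c', R, hS, hS'⟩ := h
  obtain ⟨pr, hpr, hp1, hp2⟩ := exists_pick_of_elts3_eq_cons L _ _ hS
  obtain ⟨qr, hqr, hq1, hq2⟩ := exists_pick_of_elts3_eq_cons pr.2 _ _ hp2
  have wp : wfT pr.1 = true := wfL_iff.mp hL _ (mem_of_mem_picks_fst hpr)
  have wq : wfT qr.1 = true :=
    wfL_iff.mp hL _ (mem_of_mem_picks_snd hpr (mem_of_mem_picks_fst hqr))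
  obtain ⟨ea, eb, ec⟩ := triad_factors_eq_of_two zmod_two_eq hp1 (tr3_ne_zero wp)
  obtain ⟨ea', eb', ec'⟩ := triad_factors_eq_of_two zmod_two_eq hq1 (tr3_ne_zero wq)
  have bp := wfT_iff.mp wp
  have bq := wfT_iff.mp wq
  have hz : pr.1.1 = qr.1.1 := dec_injOn bp.1.2 bq.1.2 (ea.trans ea'.symm)
  -- the two members of `flip1 L` coming from this pair of positions
  have hmem : ∀ r, r ∈ [(pr.1.1, pr.1.2.1, pr.1.2.2 ^^^ qr.1.2.2) ::
        (pr.1.1, pr.1.2.1 ^^^ qr.1.2.1, qr.1.2.2) :: qr.2,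
      (pr.1.1, pr.1.2.1 ^^^ qr.1.2.1, pr.1.2.2) :: (pr.1.1, qr.1.2.1, pr.1.2.2 ^^^ qr.1.2.2) :: qr.2] →
      r ∈ flip1 L := fun r hr => by
    simp only [flip1, List.mem_flatMap]
    exact ⟨pr, hpr, qr, hqr, by rw [if_pos hz]; exact hr⟩
  rcases hS' with hS' | hS'
  · refine ⟨(pr.1.1, pr.1.2.1, pr.1.2.2 ^^^ qr.1.2.2) :: (pr.1.1, pr.1.2.1 ^^^ qr.1.2.1, qr.1.2.2) ::
      qr.2, hmem _ (by simp), ?_⟩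
    rw [hS', elts3_cons, elts3_cons, hq2]
    congr 1
    · show triad a b c + triad a b c' = triad (dec pr.1.1) (dec pr.1.2.1) (dec (pr.1.2.2 ^^^ qr.1.2.2))
      rw [dec_xor, ea, eb, ec, ec', triad_add₃]
    · congr 1
      show triad a b' c' - triad a b c' = triad (dec pr.1.1) (dec (pr.1.2.1 ^^^ qr.1.2.1)) (dec qr.1.2.2)
      rw [dec_xor, ea, eb, eb', ec', ← triad_sub₂, sub_eq_add_F, add_comm]
  · refine ⟨(pr.1.1, pr.1.2.1 ^^^ qr.1.2.1, pr.1.2.2) :: (pr.1.1, qr.1.2.1, pr.1.2.2 ^^^ qr.1.2.2) ::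
      qr.2, hmem _ (by simp), ?_⟩
    rw [hS', elts3_cons, elts3_cons, hq2]
    congr 1
    · show triad a b c + triad a b' c = triad (dec pr.1.1) (dec (pr.1.2.1 ^^^ qr.1.2.1)) (dec pr.1.2.2)
      rw [dec_xor, ea, eb, eb', ec, triad_add₂]
    · congr 1
      show triad a b' c' - triad a b' c = triad (dec pr.1.1) (dec qr.1.2.1) (dec (pr.1.2.2 ^^^ qr.1.2.2))
      rw [dec_xor, ea, eb', ec, ec', ← triad_sub₃, sub_eq_add_F, add_comm]

/-- **Completeness of `flipsAll`:** over `ℤ₂`, every flip (the tree's `Flips`: Def. 4 with the shared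
factor in any slot and either choice of `T`) of the multiset presented by a well-formed code list is
presented by a member of `flipsAll`. [cite: KauersMoosbauer2022FlipGraphs, Def. 4] -/
theorem exists_mem_flipsAll_of_flips {L : List Tri} (hL : wfL L = true) {S' : Multiset T}
    (h : Flips (elts3 L) S') : ∃ r ∈ flipsAll L, S' = elts3 r := by
  rcases h with h | h | h
  · obtain ⟨r, hr, e⟩ := exists_mem_flip1_of_flipBase hL h
    exact ⟨r, List.mem_append_left _ hr, e⟩
  · rw [elts3_map_sw₁₂] at h
    obtain ⟨r, hr, e⟩ := exists_mem_flip1_of_flipBase (wfL_map hL s12 wfT_s12) h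
    refine ⟨r.map s12, List.mem_append_right _ (List.mem_append_left _ (List.mem_map.mpr ⟨r, hr, rfl⟩)), ?_⟩
    rw [← map_sw₁₂_map_sw₁₂ S', e, elts3_map_sw₁₂]
  · rw [elts3_map_sw₁₃] at h
    obtain ⟨r, hr, e⟩ := exists_mem_flip1_of_flipBase (wfL_map hL s13 wfT_s13) h
    refine ⟨r.map s13, List.mem_append_right _ (List.mem_append_right _ (List.mem_map.mpr ⟨r, hr, rfl⟩)), ?_⟩
    rw [← map_sw₁₃_map_sw₁₃ S', e, elts3_map_sw₁₃]

/-! ## §5 The irreducibility test and its soundness (KM Def. 2 / Prop. 3 over `ℤ₂`) -/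

/-- `v` is an `xor` of a sub-collection of the list `l` (membership in the `ℤ₂`-span, on codes).
[folklore] -/
def inSpanB (v : ℕ) : List ℕ → Bool
  | [] => v == 0
  | w :: l => inSpanB v l || inSpanB (v ^^^ w) l

/-- `0` is in every span. [folklore] -/
private theorem inSpanB_zero : ∀ l : List ℕ, inSpanB 0 l = true
  | [] => by simp [inSpanB]
  | w :: l => by simp [inSpanB, inSpanB_zero l]

/-- Spans are closed under adding a generator. [folklore] -/
private theorem inSpanB_xor_of_mem : ∀ (l : List ℕ) (v w : ℕ), w ∈ l → inSpanB v l = true →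
    inSpanB (v ^^^ w) l = true := by
  intro l
  induction l with
  | nil => intro v w hw; simp at hw
  | cons u l ih =>
    intro v w hw hv
    simp only [inSpanB, Bool.or_eq_true] at hv ⊢
    rcases List.mem_cons.mp hw with rfl | hw'
    · rcases hv with hv | hv
      · right; rwa [Nat.xor_assoc, Nat.xor_self, Nat.xor_zero]
      · left; exact hv
    · rcases hv with hv | hv
      · left; exact ih v w hw' hv
      · right
        have := ih (v ^^^ u) w hw' hv
        rwa [Nat.xor_assoc, Nat.xor_comm u w, ← Nat.xor_assoc] at this

/-- The second-factor codes of the elements of `r` whose first code is `z`. [folklore] -/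
def grp (z : ℕ) (r : List Tri) : List ℕ := (r.filter fun q => q.1 == z).map fun q => q.2.1

/-- **Irreducibility test, the written case** (Def. 2 with `A, B` over `ℤ₂`; Prop. 3's construction
removes an element `A₀⊗B₀⊗Γ₀` with `B₀ = Σ βᵢ Bᵢ` over other elements with `A`-factor `A₀`): no
element's second code lies in the `xor`-span of the second codes of the OTHER elements sharing its
first code. [cite: KauersMoosbauer2022FlipGraphs, Def. 2 and Prop. 3] -/
def irr1B (L : List Tri) : Bool := (picks L).all fun pr => !inSpanB pr.1.2.1 (grp pr.1.1 pr.2)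

/-- **Irreducibility test, all six cases of Def. 2** ("`A,B` or `B,A` or `A,Γ` or `Γ,A` or `B,Γ`
or `Γ,B`"), in the order of the tree's `Reduces`. [cite: KauersMoosbauer2022FlipGraphs, Def. 2] -/
def irrB (L : List Tri) : Bool :=
  irr1B L && irr1B (L.map s23) && irr1B (L.map s12) && irr1B (L.map cy) && irr1B (L.map cy2) &&
    irr1B (L.map s13)

/-- `enc 0 = 0`. [folklore] -/
private theorem enc_zero : enc (0 : F) = 0 := by decide

/-- **Soundness of the written case:** a list passing `irr1B` presents a multiset with no `RedBase`
reduction. [cite: KauersMoosbauer2022FlipGraphs, Def. 2 and Prop. 3] -/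
theorem not_redBase_of_irr1B {L : List Tri} (hL : wfL L = true) (hI : irr1B L = true)
    (S' : Multiset T) : ¬ RedBase (elts3 L) S' := by
  rintro ⟨a₀, b₀, c₀, R, L₁, L₀, hS, hA, hB, -, -⟩
  obtain ⟨pr, hpr, hp1, hp2⟩ := exists_pick_of_elts3_eq_cons L _ _ hS
  have wp : wfT pr.1 = true := wfL_iff.mp hL _ (mem_of_mem_picks_fst hpr)
  have bp := wfT_iff.mp wp
  obtain ⟨ea, eb, -⟩ := triad_factors_eq_of_two zmod_two_eq hp1 (tr3_ne_zero wp)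
  have ha₀ : a₀ ≠ 0 := fun h => dec_ne_zero bp.1.2 (Nat.pos_iff_ne_zero.mp bp.1.1) (ea.trans h)
  set G := grp pr.1.1 pr.2 with hG
  -- every summand `βᵢ • Bᵢ` of `B₀` is `0` or the matrix of a code in `G`
  have key : ∀ q ∈ L₁ + L₀, q.2.2 • q.1.2.1 = 0 ∨ ∃ w ∈ G, w < 16 ∧ q.2.2 • q.1.2.1 = dec w := by
    intro q hq
    have hmem : tr q.1 ∈ elts3 pr.2 := by
      rw [hp2]; exact Multiset.mem_add.mpr (Or.inl (Multiset.mem_map_of_mem _ hq))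
    obtain ⟨e, he, hte⟩ := mem_elts3.mp hmem
    have we : wfT e = true := wfL_iff.mp hL _ (mem_of_mem_picks_snd hpr he)
    have be := wfT_iff.mp we
    obtain ⟨e1, e2, -⟩ := triad_factors_eq_of_two zmod_two_eq hte (tr3_ne_zero we)
    have hα : q.2.1 = 1 := by
      rcases zmod_two_eq q.2.1 with h | h
      · exact absurd (by rw [hA q hq, h, zero_smul]) ha₀
      · exact h
    have hz : e.1 = pr.1.1 := by
      refine dec_injOn be.1.2 bp.1.2 ?_
      rw [e1, ea, hA q hq, hα, one_smul]
    have hwG : e.2.1 ∈ G := by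
      rw [hG, grp]
      exact List.mem_map.mpr ⟨e, List.mem_filter.mpr ⟨he, by simp [hz]⟩, rfl⟩
    rcases zmod_two_eq q.2.2 with h | h
    · exact Or.inl (by rw [h, zero_smul])
    · exact Or.inr ⟨e.2.1, hwG, be.2.1.2, by rw [h, one_smul, e2]⟩
  -- hence `B₀` lies in the span (on codes)
  have span : ∀ M : Multiset (((F × F × F)) × (ZMod 2 × ZMod 2)),
      (∀ q ∈ M, q.2.2 • q.1.2.1 = 0 ∨ ∃ w ∈ G, w < 16 ∧ q.2.2 • q.1.2.1 = dec w) →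
      inSpanB (enc (M.map fun q => q.2.2 • q.1.2.1).sum) G = true := by
    intro M
    induction M using Multiset.induction_on with
    | empty => intro; rw [Multiset.map_zero, Multiset.sum_zero, enc_zero]; exact inSpanB_zero G
    | cons q M ih =>
      intro hM
      have ih' := ih fun q' hq' => hM q' (Multiset.mem_cons_of_mem hq')
      rw [Multiset.map_cons, Multiset.sum_cons]
      rcases hM q (Multiset.mem_cons_self _ _) with h | ⟨w, hw, hw16, h⟩
      · rw [h, zero_add]; exact ih'
      · rw [h, add_comm, enc_add, enc_dec w hw16]
        exact inSpanB_xor_of_mem G _ w hw ih'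
  have hspan := span (L₁ + L₀) key
  rw [← hB, ← eb, enc_dec _ bp.2.1.2] at hspan
  have := List.all_eq_true.mp hI pr hpr
  rw [← hG, hspan] at this
  simp at this

/-- **Soundness of the irreducibility test:** a well-formed list passing `irrB` presents a multiset
admitting NO reduction ("`S'` is a reduction of `S`", all six cases of Def. 2).
[cite: KauersMoosbauer2022FlipGraphs, Def. 2 and Prop. 3] -/
theorem not_reduces_of_irrB {L : List Tri} (hL : wfL L = true) (hI : irrB L = true)
    (S' : Multiset T) : ¬ Reduces (elts3 L) S' := by
  simp only [irrB, Bool.and_eq_true] at hI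
  obtain ⟨⟨⟨⟨⟨h1, h2⟩, h3⟩, h4⟩, h5⟩, h6⟩ := hI
  rintro (h | h | h | h | h | h)
  · exact not_redBase_of_irr1B hL h1 S' h
  · rw [elts3_map_sw₂₃] at h
    exact not_redBase_of_irr1B (wfL_map hL s23 wfT_s23) h2 _ h
  · rw [elts3_map_sw₁₂] at h
    exact not_redBase_of_irr1B (wfL_map hL s12 wfT_s12) h3 _ h
  · rw [elts3_map_cyc] at h
    exact not_redBase_of_irr1B (wfL_map hL cy wfT_cy) h4 _ h
  · rw [elts3_map_cyc₂] at h
    exact not_redBase_of_irr1B (wfL_map hL cy2 wfT_cy2) h5 _ h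
  · rw [elts3_map_sw₁₃] at h
    exact not_redBase_of_irr1B (wfL_map hL s13 wfT_s13) h6 _ h

/-! ## §6 KM's symmetry group on codes -/

/-- The `2 × 2` matrix over `ℤ₂` with code `v` (bit `2 i + j` = entry `(i, j)`). [folklore] -/
def toMat (v : ℕ) : Matrix (Fin 2) (Fin 2) (ZMod 2) :=
  fun i j => if v.testBit (2 * i.val + j.val) then 1 else 0

/-- The codes of the six invertible `2 × 2` matrices over `ℤ₂` (`GL₂(ℤ₂)`, in increasing order:
`6, 7, 9, 11, 13, 14`; out of range: the identity `9`). [cite: KauersMoosbauer2022FlipGraphs, §2 (symmetry group; "`U` is invertible")] -/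
def glCode : ℕ → ℕ
  | 0 => 6 | 1 => 7 | 2 => 9 | 3 => 11 | 4 => 13 | 5 => 14 | _ => 9

/-- The `i`-th element of `GL₂(ℤ₂)`. [cite: KauersMoosbauer2022FlipGraphs, §2 (symmetry group)] -/
def glMat (i : ℕ) : Matrix (Fin 2) (Fin 2) (ZMod 2) := toMat (glCode i)

/-- Index of the inverse: `glMat (glInv i) = (glMat i)⁻¹`. [folklore] -/
def glInv : ℕ → ℕ
  | 0 => 0 | 1 => 5 | 2 => 2 | 3 => 3 | 4 => 4 | 5 => 1 | _ => 2

/-- Index of the transpose: `glMat (glTr i) = (glMat i)ᵀ`. [folklore] -/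
def glTr : ℕ → ℕ
  | 0 => 0 | 1 => 1 | 2 => 2 | 3 => 4 | 4 => 3 | 5 => 5 | _ => 2

/-- Every `glMat i` has determinant `1`. [folklore] -/
private theorem det_glMat (i : ℕ) : (glMat i).det = 1 := by
  rcases i with _ | _ | _ | _ | _ | _ | n
  iterate 6 decide
  have h : glMat (n + 6) = toMat 9 := rfl
  rw [h]; decide

/-- Every `glMat i` is invertible. [cite: KauersMoosbauer2022FlipGraphs, §2 (symmetry group)] -/
theorem isUnit_det_glMat (i : ℕ) : IsUnit (glMat i).det := by
  rw [det_glMat]; exact isUnit_one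

/-- The inverse table is correct. [folklore] -/
private theorem glMat_mul_glInv (i : ℕ) (hi : i < 6) : glMat i * glMat (glInv i) = 1 := by
  interval_cases i <;> decide

/-- `(glMat i)⁻¹ = glMat (glInv i)`. [folklore] -/
private theorem glMat_inv (i : ℕ) (hi : i < 6) : (glMat i)⁻¹ = glMat (glInv i) :=
  Matrix.inv_eq_right_inv (glMat_mul_glInv i hi)

/-- The transpose table is correct. [folklore] -/
private theorem glMat_transpose (i : ℕ) (hi : i < 6) : (glMat i)ᵀ = glMat (glTr i) := by
  interval_cases i <;> decide

/-- `glInv` stays in range. [folklore] -/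
private theorem glInv_lt (i : ℕ) (hi : i < 6) : glInv i < 6 := by interval_cases i <;> decide
/-- `glTr` stays in range. [folklore] -/
private theorem glTr_lt (i : ℕ) (hi : i < 6) : glTr i < 6 := by interval_cases i <;> decide

/-- The table of `X ↦ P_i X P_jᵀ` on codes: entry `[i][j][v]`. [cite: KauersMoosbauer2022FlipGraphs, §2 (symmetry group, "`AU ⊗ U⁻¹B ⊗ Γ`")] -/
def pxqTab : List (List (List ℕ)) :=
  [[[0, 8, 4, 12, 2, 10, 6, 14, 1, 9, 5, 13, 3, 11, 7, 15], [0, 12, 4, 8, 3, 15, 7, 11, 1, 13, 5, 9, 2, 14, 6, 10], [0, 4, 8, 12, 1, 5, 9, 13, 2, 6, 10, 14, 3, 7, 11, 15], [0, 4, 12, 8, 1, 5, 13, 9, 3, 7, 15, 11, 2, 6, 14, 10], [0, 12, 8, 4, 3, 15, 11, 7, 2, 14, 10, 6, 1, 13, 9, 5], [0, 8, 12, 4, 2, 10, 14, 6, 3, 11, 15, 7, 1, 9, 13, 5]],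
   [[0, 10, 5, 15, 2, 8, 7, 13, 1, 11, 4, 14, 3, 9, 6, 12], [0, 15, 5, 10, 3, 12, 6, 9, 1, 14, 4, 11, 2, 13, 7, 8], [0, 5, 10, 15, 1, 4, 11, 14, 2, 7, 8, 13, 3, 6, 9, 12], [0, 5, 15, 10, 1, 4, 14, 11, 3, 6, 12, 9, 2, 7, 13, 8], [0, 15, 10, 5, 3, 12, 9, 6, 2, 13, 8, 7, 1, 14, 11, 4], [0, 10, 15, 5, 2, 8, 13, 7, 3, 9, 12, 6, 1, 11, 14, 4]],
   [[0, 2, 1, 3, 8, 10, 9, 11, 4, 6, 5, 7, 12, 14, 13, 15], [0, 3, 1, 2, 12, 15, 13, 14, 4, 7, 5, 6, 8, 11, 9, 10], [0, 1, 2, 3, 4, 5, 6, 7, 8, 9, 10, 11, 12, 13, 14, 15], [0, 1, 3, 2, 4, 5, 7, 6, 12, 13, 15, 14, 8, 9, 11, 10], [0, 3, 2, 1, 12, 15, 14, 13, 8, 11, 10, 9, 4, 7, 6, 5], [0, 2, 3, 1, 8, 10, 11, 9, 12, 14, 15, 13, 4, 6, 7, 5]],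
   [[0, 2, 1, 3, 10, 8, 11, 9, 5, 7, 4, 6, 15, 13, 14, 12], [0, 3, 1, 2, 15, 12, 14, 13, 5, 6, 4, 7, 10, 9, 11, 8], [0, 1, 2, 3, 5, 4, 7, 6, 10, 11, 8, 9, 15, 14, 13, 12], [0, 1, 3, 2, 5, 4, 6, 7, 15, 14, 12, 13, 10, 11, 9, 8], [0, 3, 2, 1, 15, 12, 13, 14, 10, 9, 8, 11, 5, 6, 7, 4], [0, 2, 3, 1, 10, 8, 9, 11, 15, 13, 12, 14, 5, 7, 6, 4]],
   [[0, 10, 5, 15, 8, 2, 13, 7, 4, 14, 1, 11, 12, 6, 9, 3], [0, 15, 5, 10, 12, 3, 9, 6, 4, 11, 1, 14, 8, 7, 13, 2], [0, 5, 10, 15, 4, 1, 14, 11, 8, 13, 2, 7, 12, 9, 6, 3], [0, 5, 15, 10, 4, 1, 11, 14, 12, 9, 3, 6, 8, 13, 7, 2], [0, 15, 10, 5, 12, 3, 6, 9, 8, 7, 2, 13, 4, 11, 14, 1], [0, 10, 15, 5, 8, 2, 7, 13, 12, 6, 3, 9, 4, 14, 11, 1]],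
   [[0, 8, 4, 12, 10, 2, 14, 6, 5, 13, 1, 9, 15, 7, 11, 3], [0, 12, 4, 8, 15, 3, 11, 7, 5, 9, 1, 13, 10, 6, 14, 2], [0, 4, 8, 12, 5, 1, 13, 9, 10, 14, 2, 6, 15, 11, 7, 3], [0, 4, 12, 8, 5, 1, 9, 13, 15, 11, 3, 7, 10, 14, 6, 2], [0, 12, 8, 4, 15, 3, 7, 11, 10, 6, 2, 14, 5, 9, 13, 1], [0, 8, 12, 4, 10, 2, 6, 14, 15, 7, 3, 11, 5, 13, 9, 1]]]

/-- `pxq i j v` = the code of `P_i · X · P_jᵀ` for the matrix `X` with code `v`. [folklore] -/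
def pxq (i j v : ℕ) : ℕ := ((pxqTab.getD i []).getD j []).getD v 0

/-- **The table is the Kronecker action on factors:** `(P_i ⊗ₖ P_j) · X = P_i X P_jᵀ` on codes
(kernel evaluation of all `6 · 6 · 16` cases). [folklore] -/
private theorem mulVec_dec (i j v : ℕ) (hi : i < 6) (hj : j < 6) (hv : v < 16) :
    (glMat i ⊗ₖ glMat j).mulVec (dec v) = dec (pxq i j v) := by
  have key : ∀ (i j : Fin 6) (v : Fin 16),
      (glMat i.val ⊗ₖ glMat j.val).mulVec (dec v.val) = dec (pxq i.val j.val v.val) := by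
    decide +kernel
  exact key ⟨i, hi⟩ ⟨j, hj⟩ ⟨v, hv⟩

/-- `pxq` values are codes `< 16`. [folklore] -/
private theorem pxq_lt (i j v : ℕ) (hi : i < 6) (hj : j < 6) (hv : v < 16) : pxq i j v < 16 := by
  have key : ∀ (i j : Fin 6) (v : Fin 16), pxq i.val j.val v.val < 16 := by decide +kernel
  exact key ⟨i, hi⟩ ⟨j, hj⟩ ⟨v, hv⟩

/-- Transposition on codes (swap the bits of the entries `(0,1)` and `(1,0)`). [folklore] -/
def tc : ℕ → ℕ
  | 0 => 0 | 1 => 1 | 2 => 4 | 3 => 5 | 4 => 2 | 5 => 3 | 6 => 6 | 7 => 7 | 8 => 8 | 9 => 9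
  | 10 => 12 | 11 => 13 | 12 => 10 | 13 => 11 | 14 => 14 | 15 => 15 | n => n

/-- `tc` is transposition of the decoded matrix. [folklore] -/
private theorem dec_tc (v : ℕ) (hv : v < 16) : dec (tc v) = fun p => dec v p.swap := by
  have key : ∀ v : Fin 16, dec (tc v.val) = fun p => dec v.val p.swap := by decide +kernel
  exact key ⟨v, hv⟩

/-- `tc` keeps codes `< 16`. [folklore] -/
private theorem tc_lt (v : ℕ) (hv : v < 16) : tc v < 16 := by
  have key : ∀ v : Fin 16, tc v.val < 16 := by decide
  exact key ⟨v, hv⟩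

/-- KM's transposition `A⊗B⊗Γ ↦ Bᵀ⊗Aᵀ⊗Γᵀ` on code triples (tree slots: `(z,x,y) ↦ (zᵀ,yᵀ,xᵀ)`).
[cite: KauersMoosbauer2022FlipGraphs, §2 (symmetry group)] -/
def trT (t : Tri) : Tri := (tc t.1, tc t.2.2, tc t.2.1)

/-- KM's cyclic shift `A⊗B⊗Γ ↦ B⊗Γ⊗A` on code triples (tree slots: `(z,x,y) ↦ (xᵀ,y,zᵀ)`).
[cite: KauersMoosbauer2022FlipGraphs, §2 (symmetry group)] -/
def cyT (t : Tri) : Tri := (tc t.2.1, t.2.2, tc t.1)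

/-- The six words in the cyclic shift `ρ` and the transposition `τ`:
`1, τ, ρ, ρτ, ρ², ρ²τ` (applied left to right), on code triples. [cite: KauersMoosbauer2022FlipGraphs, §2 (symmetry group)] -/
def s3Tri (k : ℕ) (t : Tri) : Tri :=
  match k with
  | 0 => t | 1 => trT t | 2 => cyT t | 3 => trT (cyT t) | 4 => cyT (cyT t) | 5 => trT (cyT (cyT t))
  | _ => t

/-- The same six words as symmetries of `⟨2,2,2⟩` over `ℤ₂`.
[cite: KauersMoosbauer2022FlipGraphs, §2 (symmetry group)] -/
def s3Sym (k : ℕ) : Symmetry (matMulTensor (ZMod 2) 2 2 2) :=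
  match k with
  | 0 => Symmetry.refl _
  | 1 => Symmetry.transposeSq 2
  | 2 => Symmetry.cycleSq 2
  | 3 => (Symmetry.cycleSq 2).trans (Symmetry.transposeSq 2)
  | 4 => (Symmetry.cycleSq 2).trans (Symmetry.cycleSq 2)
  | 5 => ((Symmetry.cycleSq 2).trans (Symmetry.cycleSq 2)).trans (Symmetry.transposeSq 2)
  | _ => Symmetry.refl _

/-- The six words belong to KM's group `G`. [cite: KauersMoosbauer2022FlipGraphs, §2 (symmetry group)] -/
theorem inSymmetryGroup_s3Sym (k : ℕ) : InSymmetryGroup (s3Sym k) := by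
  rcases k with _ | _ | _ | _ | _ | _ | n
  · exact InSymmetryGroup.refl
  · exact InSymmetryGroup.transpose
  · exact InSymmetryGroup.cycle
  · exact InSymmetryGroup.cycle.trans InSymmetryGroup.transpose
  · exact InSymmetryGroup.cycle.trans InSymmetryGroup.cycle
  · exact (InSymmetryGroup.cycle.trans InSymmetryGroup.cycle).trans InSymmetryGroup.transpose
  · exact InSymmetryGroup.refl

/-- All three codes `< 16`. [folklore] -/
private def bdT (t : Tri) : Prop := t.1 < 16 ∧ t.2.1 < 16 ∧ t.2.2 < 16

/-- `trT` on presented tensors is the transposition symmetry. [cite: KauersMoosbauer2022FlipGraphs, §2 (symmetry group)] -/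
theorem transposeSq_tr3 (t : Tri) (ht : bdT t) :
    (Symmetry.transposeSq (K := ZMod 2) 2).toLinearEquiv (tr3 t) = tr3 (trT t) := by
  show transposeMap 2 (tr3 t) = tr3 (trT t)
  rw [tr3, transposeMap_triad, tr3, trT, dec_tc _ ht.1, dec_tc _ ht.2.2, dec_tc _ ht.2.1]

/-- `cyT` on presented tensors is the cyclic-shift symmetry. [cite: KauersMoosbauer2022FlipGraphs, §2 (symmetry group)] -/
theorem cycleSq_tr3 (t : Tri) (ht : bdT t) :
    (Symmetry.cycleSq (K := ZMod 2) 2).toLinearEquiv (tr3 t) = tr3 (cyT t) := by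
  show cycleMap 2 (tr3 t) = tr3 (cyT t)
  rw [tr3, cycleMap_triad, tr3, cyT, dec_tc _ ht.1, dec_tc _ ht.2.1]

/-- `trT` keeps codes `< 16`. [folklore] -/
private theorem bdT_trT {t : Tri} (ht : bdT t) : bdT (trT t) :=
  ⟨tc_lt _ ht.1, tc_lt _ ht.2.2, tc_lt _ ht.2.1⟩
/-- `cyT` keeps codes `< 16`. [folklore] -/
private theorem bdT_cyT {t : Tri} (ht : bdT t) : bdT (cyT t) :=
  ⟨tc_lt _ ht.2.1, ht.2.2, tc_lt _ ht.1⟩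

/-- The words act on presented tensors by `s3Tri`. [cite: KauersMoosbauer2022FlipGraphs, §2 (symmetry group)] -/
theorem s3Sym_tr3 (k : ℕ) (t : Tri) (ht : bdT t) :
    (s3Sym k).toLinearEquiv (tr3 t) = tr3 (s3Tri k t) := by
  rcases k with _ | _ | _ | _ | _ | _ | n
  · rfl
  · exact transposeSq_tr3 t ht
  · exact cycleSq_tr3 t ht
  · show (Symmetry.transposeSq 2).toLinearEquiv ((Symmetry.cycleSq 2).toLinearEquiv (tr3 t)) = _
    rw [cycleSq_tr3 t ht, transposeSq_tr3 _ (bdT_cyT ht)]; rfl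
  · show (Symmetry.cycleSq 2).toLinearEquiv ((Symmetry.cycleSq 2).toLinearEquiv (tr3 t)) = _
    rw [cycleSq_tr3 t ht, cycleSq_tr3 _ (bdT_cyT ht)]; rfl
  · show (Symmetry.transposeSq 2).toLinearEquiv ((Symmetry.cycleSq 2).toLinearEquiv
      ((Symmetry.cycleSq 2).toLinearEquiv (tr3 t))) = _
    rw [cycleSq_tr3 t ht, cycleSq_tr3 _ (bdT_cyT ht), transposeSq_tr3 _ (bdT_cyT (bdT_cyT ht))]; rfl
  · rfl

/-- The words keep codes `< 16`. [folklore] -/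
private theorem bdT_s3Tri (k : ℕ) {t : Tri} (ht : bdT t) : bdT (s3Tri k t) := by
  rcases k with _ | _ | _ | _ | _ | _ | n
  · exact ht
  · exact bdT_trT ht
  · exact bdT_cyT ht
  · exact bdT_trT (bdT_cyT ht)
  · exact bdT_cyT (bdT_cyT ht)
  · exact bdT_trT (bdT_cyT (bdT_cyT ht))
  · exact ht

/-- The sandwich `(P, Q, R)` (de Groote; the tree's `Symmetry.sandwich`: `X ↦ PXQᵀ`, `Y ↦ Q⁻ᵀYRᵀ`,
`Z ↦ P⁻ᵀZR⁻¹`) on code triples, by table look-ups. [cite: KauersMoosbauer2022FlipGraphs, §2 (symmetry group)] -/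
def sandTri (ip iq ir : ℕ) (t : Tri) : Tri :=
  (pxq (glTr (glInv ip)) (glTr (glInv ir)) t.1, pxq ip iq t.2.1, pxq (glTr (glInv iq)) ir t.2.2)

/-- A word `g = (k, i_P, i_Q, i_R)` for the group element `σ_k` followed by the sandwich
`(P, Q, R) = (glMat i_P, glMat i_Q, glMat i_R)`, acting on code triples.
[cite: KauersMoosbauer2022FlipGraphs, §2 (symmetry group)] -/
def actTri (g : ℕ × ℕ × ℕ × ℕ) (t : Tri) : Tri := sandTri g.2.1 g.2.2.1 g.2.2.2 (s3Tri g.1 t)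

/-- The symmetry named by the word `g`. [cite: KauersMoosbauer2022FlipGraphs, §2 (symmetry group)] -/
noncomputable def symOf (g : ℕ × ℕ × ℕ × ℕ) : Symmetry (matMulTensor (ZMod 2) 2 2 2) :=
  (s3Sym g.1).trans (Symmetry.sandwich (glMat g.2.1) (glMat g.2.2.1) (glMat g.2.2.2)
    (isUnit_det_glMat _) (isUnit_det_glMat _) (isUnit_det_glMat _))

/-- `symOf g` belongs to KM's group `G`. [cite: KauersMoosbauer2022FlipGraphs, §2 (symmetry group)] -/
theorem inSymmetryGroup_symOf (g : ℕ × ℕ × ℕ × ℕ) : InSymmetryGroup (symOf g) :=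
  (inSymmetryGroup_s3Sym g.1).trans (InSymmetryGroup.sandwich _ _ _ _ _ _)

/-- Word indices in range. [folklore] -/
def wfG (g : ℕ × ℕ × ℕ × ℕ) : Bool :=
  decide (g.1 < 6) && decide (g.2.1 < 6) && decide (g.2.2.1 < 6) && decide (g.2.2.2 < 6)

/-- The sandwich acts on presented tensors by `sandTri`. [cite: KauersMoosbauer2022FlipGraphs, §2 (symmetry group)] -/
theorem sandwich_tr3 (ip iq ir : ℕ) (hp : ip < 6) (hq : iq < 6) (hr : ir < 6) (t : Tri)
    (ht : bdT t) :
    (Symmetry.sandwich (glMat ip) (glMat iq) (glMat ir) (isUnit_det_glMat _) (isUnit_det_glMat _)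
        (isUnit_det_glMat _)).toLinearEquiv (tr3 t) = tr3 (sandTri ip iq ir t) := by
  show actTensor ((glMat ip)⁻¹ᵀ ⊗ₖ (glMat ir)⁻¹ᵀ) (glMat ip ⊗ₖ glMat iq) ((glMat iq)⁻¹ᵀ ⊗ₖ glMat ir)
      (tr3 t) = tr3 (sandTri ip iq ir t)
  rw [tr3, actTensor_triad, glMat_inv ip hp, glMat_inv iq hq, glMat_inv ir hr,
    glMat_transpose _ (glInv_lt ip hp), glMat_transpose _ (glInv_lt iq hq),
    glMat_transpose _ (glInv_lt ir hr),
    mulVec_dec _ _ _ (glTr_lt _ (glInv_lt ip hp)) (glTr_lt _ (glInv_lt ir hr)) ht.1,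
    mulVec_dec _ _ _ hp hq ht.2.1, mulVec_dec _ _ _ (glTr_lt _ (glInv_lt iq hq)) hr ht.2.2]
  rfl

/-- **`symOf g` acts on presented tensors by `actTri g`.** [cite: KauersMoosbauer2022FlipGraphs, §2 (symmetry group)] -/
theorem symOf_tr3 (g : ℕ × ℕ × ℕ × ℕ) (hg : wfG g = true) (t : Tri) (ht : bdT t) :
    (symOf g).toLinearEquiv (tr3 t) = tr3 (actTri g t) := by
  simp only [wfG, Bool.and_eq_true, decide_eq_true_eq] at hg
  obtain ⟨⟨⟨-, hp⟩, hq⟩, hr⟩ := hg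
  show (Symmetry.sandwich (glMat g.2.1) (glMat g.2.2.1) (glMat g.2.2.2) (isUnit_det_glMat _)
      (isUnit_det_glMat _) (isUnit_det_glMat _)).toLinearEquiv ((s3Sym g.1).toLinearEquiv (tr3 t)) = _
  rw [s3Sym_tr3 g.1 t ht, sandwich_tr3 _ _ _ hp hq hr _ (bdT_s3Tri g.1 ht)]
  rfl

/-- Boolean bound check: all three codes `< 16`. [folklore] -/
def bdB (t : Tri) : Bool := decide (t.1 < 16) && decide (t.2.1 < 16) && decide (t.2.2 < 16)

/-- Unpacking `bdB`. [folklore] -/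
private theorem bdT_of_bdB {t : Tri} (h : bdB t = true) : bdT t := by
  simp only [bdB, Bool.and_eq_true, decide_eq_true_eq] at h
  exact ⟨h.1.1, h.1.2, h.2⟩

/-- **On a presented multiset:** `(elts3 r).map (symOf g) = elts3 (r.map (actTri g))`.
[cite: KauersMoosbauer2022FlipGraphs, §2 (symmetry group)] -/
theorem map_symOf_elts3 (g : ℕ × ℕ × ℕ × ℕ) (hg : wfG g = true) (r : List Tri)
    (hr : ∀ t ∈ r, bdB t = true) :
    (elts3 r).map (symOf g).toLinearEquiv = elts3 (r.map (actTri g)) := by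
  simp only [elts3, Multiset.map_coe, List.map_map]
  refine congrArg _ (List.map_congr_left fun t ht => ?_)
  exact symOf_tr3 g hg t (bdT_of_bdB (hr t ht))

/-! ## §7 Matching presented multisets up to order -/

/-- A numeric key, injective on code triples with codes `< 16`. [folklore] -/
def key (t : Tri) : ℕ := t.1 * 256 + t.2.1 * 16 + t.2.2

/-- Insertion sort by the key. [folklore] -/
def sortT (L : List Tri) : List Tri := L.insertionSort fun p q => key p ≤ key q

/-- **Lists with equal sorted forms present the same multiset.** [folklore] -/
private theorem elts3_eq_of_sortT_eq {L L' : List Tri} (h : sortT L = sortT L') : elts3 L = elts3 L' := by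
  refine elts3_eq_of_perm ((List.perm_insertionSort (fun p q => key p ≤ key q) L).symm.trans ?_)
  have h' : L.insertionSort (fun p q => key p ≤ key q) = L'.insertionSort (fun p q => key p ≤ key q) := h
  rw [h']
  exact List.perm_insertionSort _ L'

/-! ## §8 The ball certificate checker and its soundness -/

/-- A witness entry: (index of the target representative, word `(k, i_P, i_Q, i_R)`). [folklore] -/
abbrev W : Type := ℕ × ℕ × ℕ × ℕ × ℕ

/-- Some code of the list is `0` (the presented multiset contains the zero tensor, so it is not a
scheme: Def. 1 requires NON-ZERO rank-one tensors). [cite: KauersMoosbauer2022FlipGraphs, Def. 1] -/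
def hasZeroB (r : List Tri) : Bool := r.any fun p => (p.1 == 0) || (p.2.1 == 0) || (p.2.2 == 0)

/-- **Matching one flip result against the table:** either the result is degenerate (a zero code),
or its codes are `< 16`, the target index is below `bound`, the word is in range, and the word maps
the result onto the target representative up to order. [cite: KauersMoosbauer2022FlipGraphs, §2 (equivalence = same orbit) and Def. 8] -/
def matchB (reps : List (List Tri)) (bound : ℕ) (r : List Tri) (w : W) : Bool :=
  hasZeroB r || (r.all bdB && decide (w.1 < bound) && wfG w.2 &&
    decide (sortT (r.map (actTri w.2)) = sortT (reps.getD w.1 [])))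

/-- Matching a list of flip results against an aligned list of witnesses. [folklore] -/
def allMatchB (reps : List (List Tri)) (bound : ℕ) : List (List Tri) → List W → Bool
  | [], _ => true
  | _ :: _, [] => false
  | r :: rs, w :: ws => matchB reps bound r w && allMatchB reps bound rs ws

/-- **The check of representative `i`:** well-formed, irreducible (Def. 2, all six cases), and — when
a successor bound is given (`i < bounds.length`) — every flip (Def. 4, `flipsAll`) is matched to a
representative of index `< bounds[i]`. [cite: KauersMoosbauer2022FlipGraphs, Def. 2, Def. 4, Def. 8] -/
def repOK (reps : List (List Tri)) (wits : List (List W)) (bounds : List ℕ) (i : ℕ) : Bool :=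
  wfL (reps.getD i []) && irrB (reps.getD i []) &&
    (if i < bounds.length then
      allMatchB reps (bounds.getD i 0) (flipsAll (reps.getD i [])) (wits.getD i []) else true)

/-- A scheme's multiset presented by a code list has no zero code. [cite: KauersMoosbauer2022FlipGraphs, Def. 1] -/
theorem hasZeroB_eq_false {t₀ : T} (y : Scheme t₀) {r : List Tri} (hy : y.elts = elts3 r) :
    hasZeroB r = false := by
  by_contra h
  rw [Bool.not_eq_false, hasZeroB, List.any_eq_true] at h
  obtain ⟨p, hp, h0⟩ := h
  have hz : p.1 = 0 ∨ p.2.1 = 0 ∨ p.2.2 = 0 := by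
    simpa [Bool.or_eq_true, beq_iff_eq, or_assoc] using h0
  exact y.ne_zero (tr3 p) (hy ▸ mem_elts3.mpr ⟨p, hp, rfl⟩) (tr3_eq_zero_of_zero hz)

/-- Soundness of `matchB` for a non-degenerate result. [cite: KauersMoosbauer2022FlipGraphs, §2 and Def. 8] -/
theorem matchB_sound {reps : List (List Tri)} {bound : ℕ} {r : List Tri} {w : W}
    (h : matchB reps bound r w = true) (hz : hasZeroB r = false) :
    w.1 < bound ∧ wfG w.2 = true ∧ (∀ t ∈ r, bdB t = true) ∧
      elts3 (r.map (actTri w.2)) = elts3 (reps.getD w.1 []) := by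
  rw [matchB, hz, Bool.false_or] at h
  simp only [Bool.and_eq_true, decide_eq_true_eq, List.all_eq_true] at h
  obtain ⟨⟨⟨hbd, hlt⟩, hg⟩, hs⟩ := h
  exact ⟨hlt, hg, hbd, elts3_eq_of_sortT_eq hs⟩

/-- Soundness of `allMatchB`: every listed result has a matching witness. [folklore] -/
private theorem allMatchB_sound {reps : List (List Tri)} {bound : ℕ} :
    ∀ (rs : List (List Tri)) (ws : List W), allMatchB reps bound rs ws = true →
      ∀ r ∈ rs, ∃ w, matchB reps bound r w = true
  | [], _, _ => by simp
  | _ :: _, [], h => by simp [allMatchB] at h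
  | r :: rs, w :: ws, h => by
    simp only [allMatchB, Bool.and_eq_true] at h
    intro r' hr'
    rcases List.mem_cons.mp hr' with rfl | hr'
    · exact ⟨w, h.1⟩
    · exact allMatchB_sound rs ws h.2 r' hr'

/-- Two schemes with the same elements are equal (bookkeeping). [folklore] -/
private theorem scheme_ext {t₀ : T} {x y : Scheme t₀} (h : x.elts = y.elts) : x = y := by
  cases x; cases y; cases h; rfl

/-- Pulling a scheme back along a symmetry: if `x = ρ·φ` elementwise then `φ⁻¹(x)` presents `ρ`.
[cite: KauersMoosbauer2022FlipGraphs, §2 (symmetry group)] -/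
theorem map_symm_elts_eq {x : Scheme (matMulTensor (ZMod 2) 2 2 2)}
    {φ : Symmetry (matMulTensor (ZMod 2) 2 2 2)} {U : Multiset T}
    (hx : x.elts = U.map φ.toLinearEquiv) : (x.map φ.symm).elts = U := by
  rw [Scheme.map_elts, hx, Multiset.map_map]
  exact (Multiset.map_congr rfl fun u _ => φ.toLinearEquiv.symm_apply_apply u).trans (Multiset.map_id U)

/-- **Soundness of the representative check, reductions:** a scheme equivalent (under KM's group) to
a representative passing `repOK` admits no reduction. [cite: KauersMoosbauer2022FlipGraphs, Def. 2, Prop. 3 and §2 ("Def. 2 is compatible with the action of the symmetry group")] -/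
theorem not_reduces_of_repOK {reps : List (List Tri)} {wits : List (List W)} {bounds : List ℕ}
    {i : ℕ} (hok : repOK reps wits bounds i = true)
    {x y : Scheme (matMulTensor (ZMod 2) 2 2 2)} {φ : Symmetry (matMulTensor (ZMod 2) 2 2 2)}
    (hφ : InSymmetryGroup φ) (hx : x.elts = (elts3 (reps.getD i [])).map φ.toLinearEquiv) :
    ¬ Reduces x.elts y.elts := by
  simp only [repOK, Bool.and_eq_true] at hok
  obtain ⟨⟨hwf, hirr⟩, -⟩ := hok
  intro hred
  have h' := hφ.symm.map_reduces (x := x) (y := y) hred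
  rw [show (x.map φ.symm).elts = elts3 (reps.getD i []) from map_symm_elts_eq hx] at h'
  exact not_reduces_of_irrB hwf hirr _ h'

/-- **Soundness of the representative check, flips:** every flip of a scheme equivalent to
representative `i` (with `i < bounds.length`) is equivalent to a representative of index
`< bounds[i]`. [cite: KauersMoosbauer2022FlipGraphs, Def. 4, Def. 8 and §3 ("if `S'` is a flip of `S` and `g ∈ G` then `g(S')` is a flip of `g(S)`")] -/
theorem flip_step_of_repOK {reps : List (List Tri)} {wits : List (List W)} {bounds : List ℕ}
    {i : ℕ} (hok : repOK reps wits bounds i = true) (hi : i < bounds.length)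
    {x y : Scheme (matMulTensor (ZMod 2) 2 2 2)} {φ : Symmetry (matMulTensor (ZMod 2) 2 2 2)}
    (hφ : InSymmetryGroup φ) (hx : x.elts = (elts3 (reps.getD i [])).map φ.toLinearEquiv)
    (hflip : Flips x.elts y.elts) :
    ∃ j, j < bounds.getD i 0 ∧ ∃ ψ : Symmetry (matMulTensor (ZMod 2) 2 2 2), InSymmetryGroup ψ ∧
      y.elts = (elts3 (reps.getD j [])).map ψ.toLinearEquiv := by
  simp only [repOK, Bool.and_eq_true, if_pos hi] at hok
  obtain ⟨⟨hwf, -⟩, hall⟩ := hok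
  -- pull the flip back to the representative
  have h' := hφ.symm.map_flips (x := x) (y := y) hflip
  rw [show (x.map φ.symm).elts = elts3 (reps.getD i []) from map_symm_elts_eq hx] at h'
  obtain ⟨r, hr, hyr⟩ := exists_mem_flipsAll_of_flips hwf h'
  obtain ⟨w, hw⟩ := allMatchB_sound _ _ hall r hr
  obtain ⟨hlt, hg, hbd, hmatch⟩ := matchB_sound hw (hasZeroB_eq_false (y.map φ.symm) hyr)
  refine ⟨w.1, hlt, (φ.symm.trans (symOf w.2)).symm, (hφ.symm.trans (inSymmetryGroup_symOf _)).symm, ?_⟩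
  -- `(φ⁻¹ y) · g` presents the target representative
  have hz : ((y.map φ.symm).map (symOf w.2)).elts = elts3 (reps.getD w.1 []) := by
    rw [Scheme.map_elts, hyr, map_symOf_elts3 _ hg r hbd, hmatch]
  have hy : y = (y.map (φ.symm.trans (symOf w.2))).map (φ.symm.trans (symOf w.2)).symm :=
    (Scheme.map_map_symm _ y).symm
  rw [hy, Scheme.map_elts, Scheme.map_trans, hz]

end Cert222

end FlipGraph

end Literature.Computability.AlgebraicComplexity
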